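import Summits.KontsevichZagierPeriods.KontsevichZagierPeriods.Theses.LiouvilleUnfolding
import Summits.KontsevichZagierPeriods.KontsevichZagierPeriods.Theorems.LiouvilleUnfoldingLogKernelConjectureIffSummit
import Summits.KontsevichZagierPeriods.KontsevichZagierPeriods.Theorems.VietaFibreKernelFormItemDictionary
import Summits.KontsevichZagierPeriods.KontsevichZagierPeriods.Theorems.AyoubSpecialisationAyoubThesisV2KernelPiSplit
import Summits.KontsevichZagierPeriods.KontsevichZagierPeriods.Theorems.HurwitzMicroSectorsNormalFormPrincipleDimOnePiLeaves

/-!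
# Position of item stmt-KontsevichZagierPeriods-0541 (`LiouvilleUnfolding.AyoubPiLocalKernel`)

Support file (`--supports` stmt-KontsevichZagierPeriods-0541) for the `π`-LOCAL KERNEL item of route
LiouvilleUnfolding: "every formal combination `c` with `KZ.eval c = 0` becomes a Kontsevich–Zagier
relation after finitely many multiplications by the disc `[π]`", filed in interface typing (for
every pinned family `P n r = [unit disc] × r`, `(lift (of ∘ P))^[N] c ∈ KZ.relations` for some `N`).
This is J. Ayoub's Conjecture 7 (*Periods and the conjectures of Grothendieck and Kontsevich–Zagier*,
EMS Newsl. 91 (2014): `Ev` injective on `P_KZ = P^eff_KZ[(2πi)⁻¹]`) transcribed to the four-move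
calculus of `KZCalculus.lean`; it is OPEN, of period-conjecture strength. Nothing here proves or
refutes it. What is recorded, unconditionally and by composition of tree theorems only:

* `ayoubPiLocalKernel_iff_piLocalKernel` — the item as filed IS the closed-term conjecture
  `KZ.PiLocalKernel` of `KZProduct.lean` (the route decl is syntactically the AyoubSpecialisation
  decl, for which the tree has `KernelForm.LocaliseAtValuePrime.ayoubPiLocalKernel_iff_piLocalKernel`);
* `ayoubPiLocalKernel_of_logKernelConjecture`, `ayoubPiLocalKernel_of_summit` — the item is implied
  by the route's open crux `LogKernelConjecture` (stmt-2837) and by the summit `KontsevichZagierPeriods`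
  (exponent `N = 0`), so it cannot be refuted short of refuting the summit;
* `logKernelConjecture_iff_ayoubPiLocalKernel_and_ayoubPiCancellation`,
  `summit_iff_ayoubPiLocalKernel_and_ayoubPiCancellation` — with its sibling stmt-0540
  (`AyoubPiCancellation`, `= KZ.PiCancellation`) the item is EXACTLY the crux, i.e. the summit
  (Kontsevich–Zagier's `P̂ = P[(2πi)⁻¹]`, *Periods* (2001), §4.1, read in both directions); in
  particular the glue item stmt-17107 (`LogKernelConjectureSplitGlue`) is the `←` direction;
* `ayoubPiLocalKernel_on_dim_le_one` — the only unconditional instance in the tree, restated in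
  the item's interface typing: on the subgroup generated by representations of KZ's rational shape
  of dimension `≤ 1` the conclusion holds with `N = 0`
  (`HurwitzMicroSectors.NormalFormPrinciple.PiBox.Dlog.mem_relations_of_eval_eq_zero_of_dim_le_one`,
  Baker).

References: M. Kontsevich, D. Zagier, *Periods* (2001), §1.2 Conjecture 1, §4.1; J. Ayoub, EMS
Newsl. 91 (2014), Def. 6, Conj. 7, Rem. 8; A. Huber, S. Müller-Stach, *Periods and Nori Motives*
(2017), Conj. 13.2.1. No definition is introduced and no statement of any item is altered.
-/

noncomputable section

open Literature.NumberTheory.Transcendental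

namespace Summit.KontsevichZagierPeriods.LiouvilleUnfolding.PiLocalKernelPosition

open Summit.KontsevichZagierPeriods.KontsevichZagierPeriods.Theses.LiouvilleUnfolding
  (AyoubPiLocalKernel AyoubPiCancellation LogKernelConjecture)

/-! ## The item as filed is `KZ.PiLocalKernel`; its sibling is `KZ.PiCancellation` -/

/-- Route LiouvilleUnfolding's `AyoubPiLocalKernel` and route AyoubSpecialisation's decl of the same
item (stmt-0541) have the same body. [folklore] -/
theorem ayoubPiLocalKernel_iff_ayoubSpecialisation :
    AyoubPiLocalKernel ↔
      Summit.KontsevichZagierPeriods.KontsevichZagierPeriods.Theses.AyoubSpecialisation.AyoubPiLocalKernel :=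
  Iff.rfl

/-- Route LiouvilleUnfolding's `AyoubPiCancellation` and route AyoubSpecialisation's decl of the same
item (stmt-0540) have the same body. [folklore] -/
theorem ayoubPiCancellation_iff_ayoubSpecialisation :
    AyoubPiCancellation ↔
      Summit.KontsevichZagierPeriods.KontsevichZagierPeriods.Theses.AyoubSpecialisation.AyoubPiCancellation :=
  Iff.rfl

/-- **Item 0541 as filed is `KZ.PiLocalKernel`** (Ayoub's Conjecture 7 in this calculus): the pinned
family exists and its left-nested iterates agree with `([π] * ·)^[N]` modulo relations
(`KernelForm.LocaliseAtValuePrime.ayoubPiLocalKernel_iff_piLocalKernel`). [cite: Ayoub2014, Conj. 7] -/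
theorem ayoubPiLocalKernel_iff_piLocalKernel : AyoubPiLocalKernel ↔ KZ.PiLocalKernel :=
  ayoubPiLocalKernel_iff_ayoubSpecialisation.trans
    Summit.KontsevichZagierPeriods.KernelForm.LocaliseAtValuePrime.ayoubPiLocalKernel_iff_piLocalKernel

/-- **Item 0540 as filed is `KZ.PiCancellation`** (`BetaCancellationLine.stub_ayoubBridge`). [folklore] -/
theorem ayoubPiCancellation_iff_piCancellation : AyoubPiCancellation ↔ KZ.PiCancellation :=
  ayoubPiCancellation_iff_ayoubSpecialisation.trans
    Summit.KontsevichZagierPeriods.KontsevichZagierPeriods.BetaCancellationLine.stub_ayoubBridge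

/-! ## The item is implied by the crux and by the summit -/

/-- `KZKernelConjecture → AyoubPiLocalKernel` (exponent `N = 0`). [folklore] -/
theorem ayoubPiLocalKernel_of_kzKernelConjecture (h : KZKernelConjecture) : AyoubPiLocalKernel :=
  ayoubPiLocalKernel_iff_piLocalKernel.2 (KZ.piLocalKernel_of_kernel h)

/-- **The route's crux implies the item**: `LogKernelConjecture → AyoubPiLocalKernel` (the five-rule
period conjecture is the four-rule one, `SpectatorLocalisation.logKernelConjecture_iff_kzKernelConjecture`,
then `N = 0`). [folklore] -/
theorem ayoubPiLocalKernel_of_logKernelConjecture (h : LogKernelConjecture) : AyoubPiLocalKernel :=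
  ayoubPiLocalKernel_of_kzKernelConjecture
    (SpectatorLocalisation.logKernelConjecture_iff_kzKernelConjecture.1 h)

/-! ## With its sibling 0540 the item is exactly the crux (= the summit) -/

/-- **Exactness of the strategist's split along `[π]`, in this route's names**:
`LogKernelConjecture ↔ AyoubPiLocalKernel ∧ AyoubPiCancellation` (stmt-2837 ↔ stmt-0541 ∧ stmt-0540).
Composition of `logKernelConjecture_iff_kzKernelConjecture`,
`AyoubSpecialisation.kzKernelConjecture_iff_piLocalKernel_and_piCancellation` and the two bridges
above. The `←` direction is the body of the glue item stmt-17107. [cite: KontsevichZagier2001, §4.1] -/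
theorem logKernelConjecture_iff_ayoubPiLocalKernel_and_ayoubPiCancellation :
    LogKernelConjecture ↔ (AyoubPiLocalKernel ∧ AyoubPiCancellation) := by
  rw [SpectatorLocalisation.logKernelConjecture_iff_kzKernelConjecture,
    Summit.KontsevichZagierPeriods.AyoubSpecialisation.kzKernelConjecture_iff_piLocalKernel_and_piCancellation,
    ayoubPiLocalKernel_iff_piLocalKernel, ayoubPiCancellation_iff_piCancellation]

/-- **The summit in the item's names**: `KontsevichZagierPeriods ↔ AyoubPiLocalKernel ∧
AyoubPiCancellation`. [cite: KontsevichZagier2001, §1.2 Conjecture 1 and §4.1] -/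
theorem summit_iff_ayoubPiLocalKernel_and_ayoubPiCancellation :
    KontsevichZagierPeriods ↔ (AyoubPiLocalKernel ∧ AyoubPiCancellation) :=
  SpectatorLocalisation.logKernelConjecture_iff_summit.symm.trans
    logKernelConjecture_iff_ayoubPiLocalKernel_and_ayoubPiCancellation

/-- **The summit implies the item**: `KontsevichZagierPeriods → AyoubPiLocalKernel`; so a refutation
of item 0541 would refute the Kontsevich–Zagier period conjecture itself.
[cite: KontsevichZagier2001, §1.2 Conjecture 1] -/
theorem ayoubPiLocalKernel_of_summit (h : KontsevichZagierPeriods) : AyoubPiLocalKernel :=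
  (summit_iff_ayoubPiLocalKernel_and_ayoubPiCancellation.1 h).1

/-- The glue of item stmt-17107 as a term: `AyoubPiLocalKernel → AyoubPiCancellation →
LogKernelConjecture`. [folklore] -/
theorem logKernelConjecture_of_ayoubPiLocalKernel_of_ayoubPiCancellation
    (h₁ : AyoubPiLocalKernel) (h₂ : AyoubPiCancellation) : LogKernelConjecture :=
  logKernelConjecture_iff_ayoubPiLocalKernel_and_ayoubPiCancellation.2 ⟨h₁, h₂⟩

/-! ## The unconditional instance: dimension `≤ 1`, rational shape -/

/-- **Item 0541 on the dimension-`≤ 1` rational subgroup, in its interface typing, with `N = 0`.**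
For every pinned family `P` and every formal `ℤ`-combination `c` of representations of KZ's rational
shape of dimensions `≤ 1` with `KZ.eval c = 0`, already `(lift (of ∘ P))^[0] c = c ∈ KZ.relations`
(`PiBox.Dlog.mem_relations_of_eval_eq_zero_of_dim_le_one`: Conjecture 1 in dimension `≤ 1`, via Baker's
theorem). The hypothesis on `P` is not used: no power of `[π]` is needed there.
[cite: KontsevichZagier2001, §1.2 Conjecture 1] -/
theorem ayoubPiLocalKernel_on_dim_le_one
    (P : ∀ n : ℕ, KZ.IntegralRep n → KZ.IntegralRep (n + 2)) (c : KZ.FormalRep)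
    (hc : c ∈ AddSubgroup.closure
      {y : KZ.FormalRep | ∃ (m : ℕ) (N : KZ.IntegralRep m), m ≤ 1 ∧ N.IsRational ∧ y = KZ.of N})
    (hv : KZ.eval c = 0) :
    ∃ N : ℕ, (⇑(FreeAbelianGroup.lift
      (fun s : (Σ n, KZ.IntegralRep n) => KZ.of (P s.1 s.2))))^[N] c ∈ KZ.relations :=
  ⟨0, by
    simpa using
      Summit.KontsevichZagierPeriods.HurwitzMicroSectors.NormalFormPrinciple.PiBox.Dlog.mem_relations_of_eval_eq_zero_of_dim_le_one
        hc hv⟩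

end Summit.KontsevichZagierPeriods.LiouvilleUnfolding.PiLocalKernelPosition

end
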